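import Literature.NumberTheory.NumberFields.TotPosUnitsModSqMonotone
import Mathlib.RingTheory.Ideal.Norm.AbsNorm
import Mathlib.Data.ZMod.Basic
import Mathlib.NumberTheory.NumberField.Basic
import Mathlib.FieldTheory.Minpoly.IsIntegrallyClosed
import Mathlib.Tactic.ComputeDegree
import HarnessLib

/-!
# Route `ByReductionTypeAtTwo` (rung K4), crux C3″ `AdditivePotGoodLowerHalfAtTwo` (item stmt-BirchSwinnertonDyer-22617):
# COUNTING DOORS FOR THE HYPOTHESIS (hlow) `2^a ≤ #(U⁺/U²)` OF THE NARROW-RANK STAMPS — `k` totally positive units, independent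
# modulo unit squares, give `2^k` classes; a residue witness at a prime of prime norm gives non-squareness
# (a `--supports 22617` helper file; seat `bsd-2adic-k4-w2` GEN 15)

HONEST FRAMING (cell `bsd-2adic`, D-0036/D-0054/D-0152): GENERIC KERNEL lemmas about the unit group of ONE number field; no elliptic
curve, no named fact, no `sorry`, no definition.  They close nothing at the `∀`-level; nothing booked; BSD is not proved by any of this.

PURPOSE.  The `m = 2` stamps `AddKatoTwo.conjA_two_<L>_of_layerBounds₂₃''` (rows `279440c1`, `293200be1`, `412992bw1`, `467928d1`) now
display exactly two hypotheses: (hlow) `2^a ≤ Nat.card (TotPosUnitsModSq A₂)` (`a = 3, 2, 3, 3`; `A₂ = ℚ(θ) ⊔ ℚ_2`, degree `12`) and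
(hsig) (degree `24`, displayed by design).  Discharging (hlow) needs `a` totally positive units of `A₂` whose `2^a − 1` non-trivial
products are not unit squares (eng-2 CERT-NARROW6-E2 v1.3 §6.1 (W): each witnessed at ONE degree-one prime).  This file is the counting
door such a discharge enters through — the `U⁺/U²` analogue of the tree's `two_pow_le_card_range_signVec` (k4-w1) — and the residue
witness in the generality needed there (any prime `p`, any non-residue `c`, any ideal of norm `p`).

* `prod_ite_mul_prod_ite_eq` — `P(ε) P(ε') = P(ε + ε') · P(ε ε')²` for subset products indexed by `ε : Fin k → 𝔽₂`.
* **`two_pow_le_card_totPosUnitsModSq_of_forall_ne_sq`** — `k` totally positive units with no non-trivial subset product a unit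
  square ⟹ `2^k ≤ #(U⁺/U²)`; spelled-out corollaries **`four_le_card_totPosUnitsModSq_of_ne_sq`** (`k = 2`, three products) and
  **`eight_le_card_totPosUnitsModSq_of_ne_sq`** (`k = 3`, seven products).
* `not_exists_eq_sq_of_map_not_isSquare` — `φ(u)` a non-square for some multiplicative `φ` ⟹ `u` is not a unit square;
  **`not_exists_eq_sq_of_absNorm_eq_prime`** — a unit `≡ c (mod I)`, `N(I) = p` prime, `c` a non-square mod `p` ⟹ not a unit square;
  principal corollary `not_exists_eq_sq_of_absNorm_span_eq_prime`.
* `not_isSquare_algebraMap_of_sq_eq`, `not_exists_eq_sq_map_of_sq_eq` — a non-square `u` of `F` with `u δ` a non-square stays a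
  non-square in `E = F(t)`, `t² = δ` (so the layer-`m` totally positive class survives in layer `m + 1`, `δ = 2 + η_m`).
* `exists_two_mul_mul_eq_add_mul_of_isIntegral` — **`2δ·𝓞_E ⊆ 𝓞_F ⊕ 𝓞_F·t`** for `E = F(t)`, `t² = δ ∈ 𝓞_F` (minimal polynomial
  with integral coefficients); `not_exists_eq_sq_of_order_map_not_isSquare` — a unit `u ∈ R`, `R ⊆ E` a subring with `N·𝓞_E ⊆ R`,
  `φ : R → S` with `φ(N)` a unit and `φ(u)` a non-square ⟹ `u` is not a unit square (so the degree-`12` residue witnesses need only the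
  order `ℤ[θ, √2, √(2+√2)]` and `N = 16·idx`, never an integral basis of the layer).

References: [FrohlichTaylor1990] Ch. V §1 (1.10)–(1.13), pp. 163–164 (unit signatures, `U⁺/U²`); [Marcus1977] Ch. 5 Thm. 22 (c)
(`‖(α)‖ = |N(α)|`); [Cohen1993] §4.1.3 (signatures and residue checks).
-/

set_option autoImplicit false
-- sibling precedent: the directory name repeats the summit name
set_option linter.dupNamespace false

noncomputable section

open scoped Classical NumberField

namespace Summit.BirchSwinnertonDyer.BirchSwinnertonDyer.Theorems.AddKatoTwo

open NumberField Literature.Geometry.Kaehler.ComplexTorus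

/-! ## §0 Subset products indexed by `𝔽₂`-vectors -/

section SubsetProducts

variable {M : Type*} [CommMonoid M]

/-- **`P(ε) P(ε') = P(ε + ε') · P(ε ε')²`** for the subset products `P(ε) = ∏_{ε i = 1} u i` of a family `u : Fin k → M` in a
commutative monoid (`ε ε'` the pointwise product): factor by factor, `(ε i, ε' i) = (1, 1)` contributes `u i · u i = 1 · (u i)²` and
the other three cases are tautologies. [cite: FrohlichTaylor1990, Ch. V §1 (1.10)–(1.12), pp. 163–164] -/
theorem prod_ite_mul_prod_ite_eq {k : ℕ} (u : Fin k → M) (ε ε' : Fin k → ZMod 2) :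
    (∏ i, if ε i = 1 then u i else 1) * (∏ i, if ε' i = 1 then u i else 1) =
      (∏ i, if (ε + ε') i = 1 then u i else 1) * (∏ i, if (ε * ε') i = 1 then u i else 1) ^ 2 := by
  rw [← Finset.prod_pow, ← Finset.prod_mul_distrib, ← Finset.prod_mul_distrib]
  refine Finset.prod_congr rfl fun i _ => ?_
  have h01 : ∀ a : ZMod 2, a = 0 ∨ a = 1 := by decide
  have hz : (0 : ZMod 2) ≠ 1 := by decide
  have h11 : (1 : ZMod 2) + 1 = 0 := by decide
  rcases h01 (ε i) with h | h <;> rcases h01 (ε' i) with h' | h' <;>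
    simp [Pi.add_apply, Pi.mul_apply, h, h', hz, h11, pow_two]

end SubsetProducts

/-! ## §1 `2^k ≤ #(U⁺/U²)` from `k` independent totally positive units -/

section Counting

variable {K : Type} [Field K] [NumberField K]

/-- **`#(U⁺/U²) ≥ 2^k` from `k` totally positive units no non-trivial subset product of which is the square of a unit.**  The map
`ε ↦ [∏_{ε i = 1} u i]`, `𝔽₂^k → U⁺/U²`, is injective: `[P(ε)] = [P(ε')]` gives `P(ε) = w² P(ε')`, whence (by `prod_ite_mul_prod_ite_eq`)
`P(ε + ε') = (w P(ε') P(εε')⁻¹)²`, so `ε + ε' = 0`, i.e. `ε = ε'` over `𝔽₂`.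
[cite: FrohlichTaylor1990, Ch. V §1 (1.10)–(1.12), pp. 163–164] -/
theorem two_pow_le_card_totPosUnitsModSq_of_forall_ne_sq {k : ℕ} (u : Fin k → (𝓞 K)ˣ)
    (hu : ∀ (i : Fin k) (σ : K →+* ℝ), 0 < σ (((u i : (𝓞 K)ˣ) : 𝓞 K) : K))
    (hind : ∀ ε : Fin k → ZMod 2, ε ≠ 0 → ∀ w : (𝓞 K)ˣ, (∏ i, if ε i = 1 then u i else 1) ≠ w ^ 2) :
    2 ^ k ≤ Nat.card (TotPosUnitsModSq K) := by
  classical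
  have hpos : ∀ (ε : Fin k → ZMod 2) (σ : K →+* ℝ),
      0 < σ ((((∏ i, if ε i = 1 then u i else 1 : (𝓞 K)ˣ)) : 𝓞 K) : K) := by
    intro ε σ
    rw [Units.coe_prod, RingOfIntegers.coe_eq_algebraMap, map_prod, map_prod]
    refine Finset.prod_pos fun i _ => ?_
    split_ifs
    · exact hu i σ
    · simp
  set f : (Fin k → ZMod 2) → TotPosUnitsModSq K :=
    fun ε => Quot.mk _ ⟨∏ i, if ε i = 1 then u i else 1, hpos ε⟩ with hf
  have hinj : Function.Injective f := by
    intro ε ε' h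
    obtain ⟨w, hw⟩ := (totPosUnitsModSq_mk_eq_mk_iff K _ _).mp h
    have hw' : (∏ i, if ε i = 1 then u i else 1) = w ^ 2 * ∏ i, if ε' i = 1 then u i else 1 := hw
    by_contra hne
    have hne' : ε + ε' ≠ 0 := by
      intro h0
      apply hne
      have h1 : ε = -ε' := eq_neg_of_add_eq_zero_left h0
      funext i
      rw [h1, Pi.neg_apply, ZMod.neg_eq_self_mod_two]
    have hid := prod_ite_mul_prod_ite_eq u ε ε'
    -- `P(ε + ε') · P(εε')² = (w P(ε'))²`
    have hsq : (∏ i, if (ε + ε') i = 1 then u i else 1) * (∏ i, if (ε * ε') i = 1 then u i else 1) ^ 2 =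
        (w * ∏ i, if ε' i = 1 then u i else 1) ^ 2 := by
      rw [← hid, hw', mul_pow, pow_two, pow_two]
      simp only [mul_assoc, mul_comm, mul_left_comm]
    refine hind (ε + ε') hne' ((w * ∏ i, if ε' i = 1 then u i else 1) * (∏ i, if (ε * ε') i = 1 then u i else 1)⁻¹) ?_
    rw [mul_pow, inv_pow]
    exact eq_mul_inv_of_mul_eq hsq
  have h := Nat.card_le_card_of_injective f hinj
  rwa [Nat.card_fun, Nat.card_eq_fintype_card (α := ZMod 2), ZMod.card, Nat.card_eq_fintype_card, Fintype.card_fin] at h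

/-- **`k = 2`: `4 ≤ #(U⁺/U²)`** from two totally positive units `u, v` with `u`, `v`, `u v` not unit squares.
[cite: FrohlichTaylor1990, Ch. V §1 (1.10)–(1.12), pp. 163–164] -/
theorem four_le_card_totPosUnitsModSq_of_ne_sq (u v : (𝓞 K)ˣ)
    (hu : ∀ σ : K →+* ℝ, 0 < σ ((u : 𝓞 K) : K)) (hv : ∀ σ : K →+* ℝ, 0 < σ ((v : 𝓞 K) : K))
    (h₁ : ∀ w : (𝓞 K)ˣ, u ≠ w ^ 2) (h₂ : ∀ w : (𝓞 K)ˣ, v ≠ w ^ 2) (h₁₂ : ∀ w : (𝓞 K)ˣ, u * v ≠ w ^ 2) :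
    4 ≤ Nat.card (TotPosUnitsModSq K) := by
  have h01 : ∀ a : ZMod 2, a = 0 ∨ a = 1 := by decide
  have hz : (0 : ZMod 2) ≠ 1 := by decide
  refine two_pow_le_card_totPosUnitsModSq_of_forall_ne_sq (k := 2) ![u, v] (fun i σ => ?_) (fun ε hε w => ?_)
  · fin_cases i
    · exact hu σ
    · exact hv σ
  · rw [Fin.prod_univ_two]
    rcases h01 (ε 0) with h0 | h0 <;> rcases h01 (ε 1) with h1 | h1
    · exact absurd (funext fun i => by fin_cases i <;> assumption) hε
    all_goals simp only [h0, h1, hz, if_true, if_false, Matrix.cons_val_zero, Matrix.cons_val_one, one_mul, mul_one]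
    exacts [h₂ w, h₁ w, h₁₂ w]

/-- **`k = 3`: `8 ≤ #(U⁺/U²)`** from three totally positive units `u, v, x` none of whose seven non-trivial products
`u, v, x, uv, ux, vx, uvx` is a unit square (the shape of hypothesis (hlow), `a = 3`, of the `m = 2` narrow-rank stamps).
[cite: FrohlichTaylor1990, Ch. V §1 (1.10)–(1.12), pp. 163–164] -/
theorem eight_le_card_totPosUnitsModSq_of_ne_sq (u v x : (𝓞 K)ˣ)
    (hu : ∀ σ : K →+* ℝ, 0 < σ ((u : 𝓞 K) : K)) (hv : ∀ σ : K →+* ℝ, 0 < σ ((v : 𝓞 K) : K))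
    (hx : ∀ σ : K →+* ℝ, 0 < σ ((x : 𝓞 K) : K))
    (h₁ : ∀ w : (𝓞 K)ˣ, u ≠ w ^ 2) (h₂ : ∀ w : (𝓞 K)ˣ, v ≠ w ^ 2) (h₃ : ∀ w : (𝓞 K)ˣ, x ≠ w ^ 2)
    (h₁₂ : ∀ w : (𝓞 K)ˣ, u * v ≠ w ^ 2) (h₁₃ : ∀ w : (𝓞 K)ˣ, u * x ≠ w ^ 2) (h₂₃ : ∀ w : (𝓞 K)ˣ, v * x ≠ w ^ 2)
    (h₁₂₃ : ∀ w : (𝓞 K)ˣ, u * v * x ≠ w ^ 2) :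
    8 ≤ Nat.card (TotPosUnitsModSq K) := by
  have h01 : ∀ a : ZMod 2, a = 0 ∨ a = 1 := by decide
  have hz : (0 : ZMod 2) ≠ 1 := by decide
  refine two_pow_le_card_totPosUnitsModSq_of_forall_ne_sq (k := 3) ![u, v, x] (fun i σ => ?_) (fun ε hε w => ?_)
  · fin_cases i
    · exact hu σ
    · exact hv σ
    · exact hx σ
  · rw [Fin.prod_univ_three]
    rcases h01 (ε 0) with h0 | h0 <;> rcases h01 (ε 1) with h1 | h1 <;> rcases h01 (ε 2) with h2 | h2
    · exact absurd (funext fun i => by fin_cases i <;> assumption) hε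
    all_goals simp only [h0, h1, h2, hz, if_true, if_false, Matrix.cons_val_zero, Matrix.cons_val_one,
      Matrix.cons_val_two, Matrix.head_cons, Matrix.tail_cons, one_mul, mul_one]
    exacts [h₃ w, h₂ w, h₂₃ w, h₁ w, h₁₃ w, h₁₂ w, h₁₂₃ w]

end Counting

/-! ## §2 Residue witnesses of non-squareness -/

section Residue

variable {K : Type} [Field K] [NumberField K]

omit [NumberField K] in
/-- **A unit whose image under a multiplicative map is not a square is not the square of a unit** (the shape of every residue
witness: `φ` the reduction modulo a prime, or any evaluation homomorphism of a model ring). [cite: Cohen1993, §4.1.3] -/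
theorem not_exists_eq_sq_of_map_not_isSquare {R F : Type*} [CommMonoid R] [FunLike F (𝓞 K) R] [MonoidHomClass F (𝓞 K) R]
    (φ : F) (u : (𝓞 K)ˣ) (h : ¬ IsSquare (φ (u : 𝓞 K))) : ¬ ∃ ε : (𝓞 K)ˣ, u = ε ^ 2 := by
  rintro ⟨ε, hε⟩
  refine h ⟨φ (ε : 𝓞 K), ?_⟩
  rw [hε, Units.val_pow_eq_pow_val, map_pow, pow_two]

/-- **A unit congruent to a non-residue modulo an ideal of prime norm is not the square of a unit**: if `N(I) = p` is prime then
`𝓞 K / I ≅ 𝔽_p`, and `u ≡ c (mod I)` with `c` a non-square mod `p` cannot be `ε²`.  Stated with the congruence as `u − c ∈ I`.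
[cite: Marcus1977, Ch. 5 Thm. 22 (c)] [cite: Cohen1993, §4.1.3] -/
theorem not_exists_eq_sq_of_absNorm_eq_prime {p : ℕ} (hp : p.Prime) (u : (𝓞 K)ˣ) (I : Ideal (𝓞 K))
    (hI : Ideal.absNorm I = p) (c : ℤ) (hc : ¬ IsSquare ((c : ZMod p))) (hcong : (u : 𝓞 K) - c ∈ I) :
    ¬ ∃ ε : (𝓞 K)ˣ, u = ε ^ 2 := by
  rintro ⟨ε, hε⟩
  have hcard : Nat.card (𝓞 K ⧸ I) = p := by rw [← Submodule.cardQuot_apply, ← Ideal.absNorm_apply, hI]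
  haveI : Finite (𝓞 K ⧸ I) := Nat.finite_of_card_ne_zero (by rw [hcard]; exact hp.ne_zero)
  letI : Fintype (𝓞 K ⧸ I) := Fintype.ofFinite _
  have hcard' : Fintype.card (𝓞 K ⧸ I) = p := by rw [← Nat.card_eq_fintype_card, hcard]
  set ψ : ZMod p ≃+* 𝓞 K ⧸ I := ZMod.ringEquivOfPrime (𝓞 K ⧸ I) hp hcard' with hψ
  -- in the quotient, `ε̄² = ū = c̄`
  have hq : Ideal.Quotient.mk I ((ε : 𝓞 K) ^ 2) = (c : 𝓞 K ⧸ I) := by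
    have h1 : (ε : 𝓞 K) ^ 2 = (u : 𝓞 K) := by rw [hε, Units.val_pow_eq_pow_val]
    rw [h1, ← sub_eq_zero, ← map_intCast (Ideal.Quotient.mk I), ← map_sub, Ideal.Quotient.eq_zero_iff_mem]
    exact hcong
  set w : ZMod p := ψ.symm (Ideal.Quotient.mk I (ε : 𝓞 K)) with hw
  have hw2 : w ^ 2 = (c : ZMod p) := by
    rw [hw, ← map_pow, ← map_pow, hq, map_intCast]
  exact hc ⟨w, by rw [← hw2, pow_two]⟩

/-- **Principal form**: `|N(π)| = p` prime and `u ≡ c (mod π)` with `c` a non-square mod `p` ⟹ `u` is not a unit square.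
[cite: Marcus1977, Ch. 5 Thm. 22 (c) (`‖(α)‖ = |N(α)|`)] [cite: Cohen1993, §4.1.3] -/
theorem not_exists_eq_sq_of_absNorm_span_eq_prime {p : ℕ} (hp : p.Prime) (u : (𝓞 K)ˣ) (π : 𝓞 K)
    (hπ : (Algebra.norm ℤ π).natAbs = p) (c : ℤ) (hc : ¬ IsSquare ((c : ZMod p)))
    (hcong : (u : 𝓞 K) - c ∈ Ideal.span {π}) : ¬ ∃ ε : (𝓞 K)ˣ, u = ε ^ 2 :=
  not_exists_eq_sq_of_absNorm_eq_prime hp u (Ideal.span {π}) (by rw [Ideal.absNorm_span_singleton, hπ]) c hc hcong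

end Residue

/-! ## §3 Lifting non-squares through a quadratic layer `E = F(t)`, `t² = δ` (the layer-`m` class survives in layer `m + 1`) -/

section QuadraticLift

/-- **A non-square of `F` stays a non-square in a quadratic extension `E = F(t)`, `t² = δ`, unless `u·δ` is a square in `F`**:
if `u = (x + y t)²` then `2xy = 0` and `u = x² + δy²`, so `u = x²` or `u δ = (δ y)²`. Stated for any `F`-algebra `E` spanned by
`1, t` with `t ∉ F` and `2 ≠ 0`. [cite: FrohlichTaylor1990, Ch. V §1, p. 163–164] [cite: Cohen1993, §4.1.3] -/
theorem not_isSquare_algebraMap_of_sq_eq {F E : Type*} [Field F] [Field E] [Algebra F E] (t : E) (δ : F)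
    (ht : t ^ 2 = algebraMap F E δ) (hspan : ∀ z : E, ∃ x y : F, z = algebraMap F E x + algebraMap F E y * t)
    (htF : ∀ x : F, algebraMap F E x ≠ t) (h2 : (2 : F) ≠ 0) {u : F} (hu : ¬ IsSquare u) (huδ : ¬ IsSquare (u * δ)) :
    ¬ IsSquare (algebraMap F E u) := by
  rintro ⟨z, hz⟩
  obtain ⟨x, y, rfl⟩ := hspan z
  -- `u = x² + δ y² + 2xy·t`
  have hlin : algebraMap F E (u - x ^ 2 - δ * y ^ 2) = algebraMap F E (2 * x * y) * t := by
    simp only [map_sub, map_mul, map_pow, map_ofNat]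
    have := hz
    linear_combination this + (algebraMap F E y) ^ 2 * ht
  -- independence of `1, t`: the coefficient of `t` vanishes
  have hxy : 2 * x * y = 0 := by
    by_contra hne
    have hne' : algebraMap F E (2 * x * y) ≠ 0 := (map_ne_zero _).mpr hne
    apply htF ((u - x ^ 2 - δ * y ^ 2) / (2 * x * y))
    rw [map_div₀, hlin]
    exact mul_div_cancel_left₀ t hne'
  have hu' : u = x ^ 2 + δ * y ^ 2 := by
    have h0 : algebraMap F E (u - x ^ 2 - δ * y ^ 2) = 0 := by rw [hlin, hxy, map_zero, zero_mul]
    have := (map_eq_zero _).mp h0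
    linear_combination this
  rcases mul_eq_zero.mp hxy with h | h
  · rcases mul_eq_zero.mp h with h | h
    · exact h2 h
    · exact huδ ⟨δ * y, by rw [hu', h]; ring⟩
  · exact hu ⟨x, by rw [hu', h]; ring⟩

/-- **Unit form**: a unit of `𝓞 F` with `u`, `u δ` non-squares in `F` is not the square of a unit of `𝓞 E`, `E = F(t)`, `t² = δ`.
[cite: FrohlichTaylor1990, Ch. V §1, p. 163–164] -/
theorem not_exists_eq_sq_map_of_sq_eq {F E : Type*} [Field F] [Field E] [Algebra F E] (t : E) (δ : F)
    (ht : t ^ 2 = algebraMap F E δ) (hspan : ∀ z : E, ∃ x y : F, z = algebraMap F E x + algebraMap F E y * t)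
    (htF : ∀ x : F, algebraMap F E x ≠ t) (h2 : (2 : F) ≠ 0) (u : (𝓞 F)ˣ) (hu : ¬ IsSquare ((u : 𝓞 F) : F))
    (huδ : ¬ IsSquare (((u : 𝓞 F) : F) * δ)) :
    ¬ ∃ ε : (𝓞 E)ˣ, Units.map (algebraMap (𝓞 F) (𝓞 E) : 𝓞 F →* 𝓞 E) u = ε ^ 2 := by
  rintro ⟨ε, hε⟩
  refine not_isSquare_algebraMap_of_sq_eq t δ ht hspan htF h2 hu huδ ⟨((ε : 𝓞 E) : E), ?_⟩
  have h := congrArg (fun w : (𝓞 E)ˣ => ((w : 𝓞 E) : E)) hε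
  simp only [Units.coe_map, MonoidHom.coe_coe, Units.val_pow_eq_pow_val] at h
  push_cast at h
  rw [← pow_two, ← h]
  exact (IsScalarTower.algebraMap_apply (𝓞 F) (𝓞 E) E _).symm.trans (IsScalarTower.algebraMap_apply (𝓞 F) F E _)

end QuadraticLift

/-! ## §4 Orders suffice for the non-square step: `2δ·𝓞_{F(t)} ⊆ 𝓞_F ⊕ 𝓞_F t` and residue maps on an order -/

section Orders

open Polynomial

/-- **`2δ · 𝓞_E ⊆ 𝓞_F ⊕ 𝓞_F·t` for a quadratic layer `E = F(t)`, `t² = δ ∈ 𝓞_F`**: an algebraic integer `z = x + y t` of `E`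
(`x, y ∈ F`) has minimal polynomial `X² − 2x·X + (x² − δy²)` over `F` with coefficients in `𝓞_F`, so `2x ∈ 𝓞_F` and
`(2δy)² = δ((2x)² − 4(x² − δy²)) ∈ 𝓞_F`, whence `2δ z = δ(2x) + (2δy) t` with both coefficients in `𝓞_F`.  (The index of
`𝓞_F[t]` in `𝓞_E` is supported on the primes of `2δ`: the non-square step of the narrow-rank certificates needs no integral basis
of the upper layer.) [cite: Marcus1977, Ch. 2 Thm. 1 and Ex. 41 (quadratic orders)] [cite: NeukirchANT1999, Ch. I (2.4), (2.9)] -/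
theorem exists_two_mul_mul_eq_add_mul_of_isIntegral {F E : Type*} [Field F] [NumberField F] [Field E] [Algebra F E]
    (t : E) (δ : 𝓞 F) (ht : t ^ 2 = algebraMap F E δ)
    (hspan : ∀ z : E, ∃ x y : F, z = algebraMap F E x + algebraMap F E y * t)
    (htF : ∀ x : F, algebraMap F E x ≠ t) {z : E} (hz : IsIntegral ℤ z) :
    ∃ a b : 𝓞 F, algebraMap F E (2 * (δ : F)) * z = algebraMap F E a + algebraMap F E b * t := by
  obtain ⟨x, y, rfl⟩ := hspan z
  have hinj : Function.Injective (algebraMap F E) := (algebraMap F E).injective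
  have hδ : (δ : F) = algebraMap (𝓞 F) F δ := rfl
  by_cases hy : y = 0
  · -- `z = x ∈ F` is an algebraic integer of `F`
    subst hy
    have hx : IsIntegral ℤ x := by
      have h := hz
      rw [map_zero, zero_mul, add_zero] at h
      exact (isIntegral_algHom_iff (IsScalarTower.toAlgHom ℤ F E) hinj).mp h
    refine ⟨2 * δ * ⟨x, (mem_integralClosure_iff ℤ F).mpr hx⟩, 0, ?_⟩
    have hval : ((2 * δ * ⟨x, (mem_integralClosure_iff ℤ F).mpr hx⟩ : 𝓞 F) : F) = 2 * (δ : F) * x := by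
      push_cast; rfl
    rw [hval]
    simp only [map_zero, zero_mul, add_zero, map_mul, map_ofNat]
  · -- the quadratic case: `minpoly F z = X² − 2x X + (x² − δ y²)` has integral coefficients
    letI : Algebra (𝓞 F) E := ((algebraMap F E).comp (algebraMap (𝓞 F) F)).toAlgebra
    haveI : IsScalarTower (𝓞 F) F E := IsScalarTower.of_algebraMap_eq (fun _ => rfl)
    set z : E := algebraMap F E x + algebraMap F E y * t with hzdef
    have hzO : IsIntegral (𝓞 F) z := hz.tower_top
    have hzF : IsIntegral F z := hz.tower_top
    set q : F[X] := X ^ 2 - C (2 * x) * X + C (x ^ 2 - (δ : F) * y ^ 2) with hq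
    have hqdeg : q.natDegree = 2 := by rw [hq]; compute_degree!
    have hqm : q.Monic := by rw [hq]; monicity!
    have hqz : aeval z q = 0 := by
      rw [hq]
      simp only [map_add, map_sub, map_mul, map_pow, map_ofNat, aeval_C, aeval_X, hzdef]
      linear_combination (algebraMap F E y) ^ 2 * ht
    have hznot : z ∉ (algebraMap F E).range := by
      rintro ⟨w, hw⟩
      apply htF ((w - x) / y)
      rw [map_div₀, map_sub, hw, hzdef, div_eq_iff ((_root_.map_ne_zero _).mpr hy)]
      ring
    have hmin : minpoly F z = q := by
      have hdvd : minpoly F z ∣ q := minpoly.dvd F z hqz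
      have h2 : 2 ≤ (minpoly F z).natDegree := (minpoly.two_le_natDegree_iff hzF).mpr hznot
      exact (eq_of_monic_of_dvd_of_natDegree_le (minpoly.monic hzF) hqm hdvd (by rw [hqdeg]; exact h2)).symm
    -- integral coefficients
    have hint : minpoly F z = (minpoly (𝓞 F) z).map (algebraMap (𝓞 F) F) :=
      minpoly.isIntegrallyClosed_eq_field_fractions' F hzO
    have hcoeff : ∀ n, q.coeff n = algebraMap (𝓞 F) F ((minpoly (𝓞 F) z).coeff n) := by
      intro n; rw [← hmin, hint, coeff_map]
    set a₁ : 𝓞 F := (minpoly (𝓞 F) z).coeff 1 with ha₁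
    set a₀ : 𝓞 F := (minpoly (𝓞 F) z).coeff 0 with ha₀
    have hA1 : algebraMap (𝓞 F) F a₁ = -(2 * x) := by
      rw [ha₁, ← hcoeff 1, hq]
      simp only [coeff_add, coeff_sub, coeff_X_pow, coeff_C_mul, coeff_X, coeff_C]
      norm_num
    have hA0 : algebraMap (𝓞 F) F a₀ = x ^ 2 - (δ : F) * y ^ 2 := by
      rw [ha₀, ← hcoeff 0, hq]
      simp only [coeff_add, coeff_sub, coeff_X_pow, coeff_C_mul, coeff_X, coeff_C]
      norm_num
    -- `(2δy)² = δ (a₁² − 4 a₀)` is integral, hence so is `2δy`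
    have hb2 : (2 * (δ : F) * y) ^ 2 = algebraMap (𝓞 F) F (δ * (a₁ ^ 2 - 4 * a₀)) := by
      rw [map_mul, map_sub, map_mul, map_pow, map_ofNat, hA1, hA0, ← hδ]; ring
    have hbint : IsIntegral ℤ (2 * (δ : F) * y) := by
      refine IsIntegral.of_pow two_pos ?_
      rw [hb2]; exact RingOfIntegers.isIntegral_coe _
    obtain ⟨b, hb⟩ : ∃ b : 𝓞 F, (b : F) = 2 * (δ : F) * y := ⟨⟨2 * (δ : F) * y, (mem_integralClosure_iff ℤ F).mpr hbint⟩, rfl⟩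
    refine ⟨-(δ * a₁), b, ?_⟩
    have ha : ((-(δ * a₁) : 𝓞 F) : F) = 2 * (δ : F) * x := by
      rw [RingOfIntegers.coe_eq_algebraMap, map_neg, map_mul, hA1, ← hδ]; ring
    rw [ha, hb, hzdef]
    simp only [map_mul, map_ofNat]
    ring

/-- **Non-square witness through an ORDER**: if `R ⊆ E` is a subring with `N · 𝓞_E ⊆ R` for an integer `N`, `φ : R → S` a ring map
with `φ(N)` a unit (e.g. `S = 𝔽_ℓ`, `ℓ ∤ N`), and `u ∈ R` a unit of `𝓞_E` with `φ(u)` a non-square, then `u` is not the square of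
a unit of `𝓞_E`: from `u = ε²`, `Nε ∈ R` and `φ(N)² φ(u) = φ(Nε)²`.  (With `exists_two_mul_mul_eq_add_mul_of_isIntegral` twice,
`N = 16 · idx` serves for `R = ℤ[θ, √2, √(2+√2)]` in the layer-`2` fields.) [cite: Cohen1993, §4.1.3] [cite: Marcus1977, Ch. 2 Ex. 41] -/
theorem not_exists_eq_sq_of_order_map_not_isSquare {E S : Type*} [Field E] [NumberField E] [CommRing S]
    (R : Subring E) (N : ℤ) (hN : ∀ w : 𝓞 E, (N : E) * (w : E) ∈ R) (φ : R →+* S)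
    (hφN : IsUnit (φ ⟨(N : E), intCast_mem R N⟩))
    (u : (𝓞 E)ˣ) (hu : ((u : 𝓞 E) : E) ∈ R) (hns : ¬ IsSquare (φ ⟨((u : 𝓞 E) : E), hu⟩)) :
    ¬ ∃ ε : (𝓞 E)ˣ, u = ε ^ 2 := by
  rintro ⟨ε, hε⟩
  obtain ⟨n, hn⟩ := hφN
  have hmem : (N : E) * ((ε : 𝓞 E) : E) ∈ R := hN ε
  -- `(N ε)² = N² u` inside `R`
  have hsq : (⟨(N : E) * ((ε : 𝓞 E) : E), hmem⟩ : R) ^ 2 =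
      ⟨(N : E), intCast_mem R N⟩ ^ 2 * ⟨((u : 𝓞 E) : E), hu⟩ := by
    apply Subtype.ext
    simp only [SubmonoidClass.mk_pow, Subring.coe_mul]
    have h1 : ((u : 𝓞 E) : E) = ((ε : 𝓞 E) : E) ^ 2 := by
      rw [hε, Units.val_pow_eq_pow_val]; push_cast; rfl
    rw [h1]; ring
  apply hns
  refine ⟨φ ⟨(N : E) * ((ε : 𝓞 E) : E), hmem⟩ * ↑n⁻¹, ?_⟩
  have h := congrArg φ hsq
  rw [map_pow, map_mul, map_pow, ← hn] at h
  -- `φ(u) = (φ(Nε) n⁻¹)²`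
  calc φ ⟨((u : 𝓞 E) : E), hu⟩ = (↑n⁻¹ * ↑n) ^ 2 * φ ⟨((u : 𝓞 E) : E), hu⟩ := by rw [Units.inv_mul, one_pow, one_mul]
    _ = ↑n⁻¹ ^ 2 * ((n : S) ^ 2 * φ ⟨((u : 𝓞 E) : E), hu⟩) := by ring
    _ = ↑n⁻¹ ^ 2 * φ ⟨(N : E) * ((ε : 𝓞 E) : E), hmem⟩ ^ 2 := by rw [← h]
    _ = _ := by ring

end Orders

end Summit.BirchSwinnertonDyer.BirchSwinnertonDyer.Theorems.AddKatoTwo
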